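import Summits.BirchSwinnertonDyer.BirchSwinnertonDyer.Theorems.ThetaPartnerAtTwoSignedKatoUpToAtTwoLayerSideTransfer
import Summits.BirchSwinnertonDyer.BirchSwinnertonDyer.Theorems.ThetaPartnerAtTwoSignedKatoUpToAtTwoLayerPairingCompat
import Literature.NumberTheory.EllipticCurves.Kato2004.IwasawaCohomologyExistsProofs
import HarnessLib

/-!
# Route `ThetaPartnerAtTwo` (TP2), crux K3 `SignedKatoDivisibilityUpToAtTwo` (item stmt-BirchSwinnertonDyer-20308),
# line `colemanrat` v8 — stub (S3′) `stub_layerSideNoPTTwo` REDUCED TO ITS PUBLISHED CORE: the transfer theorem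

Width seat `bsd-wall-tp2-p2x-w3` g5 (cell `bsd-wall`). HONEST FRAMING: theorems only — one elementary Weil-pairing lemma and ONE
implication between two fully spelled statements (no definition, no named fact, no instance, no `sorry`); closes no item; K3 is
NOT settled and BSD is NOT proved by any of this.

## What is here

The registered stub (S3′) `Cruxes.SignedKatoDivisibilityUpToAtTwo.ColemanRat.stub_layerSideNoPTTwo` of skeleton v8 asks, per place
`v ∋ 2`, habitat datum and height-one `𝔭 ∌ 2`, for: a local lift `g` of the topological generator, a plus Honda system `d`
((L)(TR)(GEN)(GEN₀)), a pinned Iwasawa cohomology `I = 𝐇¹_Γ(T₂E)`, `ℤ₂`-linear LAYER PAIRINGS `pair n : H¹(ℚ_n, T₂E) →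
Hom(E(ℚ_{2,n}·ℚ_v), ℤ₂)` with (P1) (P2), a compatible bilinear Galois-equivariant Weil family `e_k` on `E[2^k]` ((WEIL)) such that
(P3) the residues of `pair` modulo `2^k` ARE the finite local Tate pairings `LayerPairing.layerPairingPk … e_k …` of the (D-layer)
construction, a genuine `2`-adic Euler-system class `s ∈ 𝐇¹` ((ES)) and the explicit reciprocity law at `2` in ♭-Coleman
currency ((ERL♭)).  Of these, the tree PROVES unconditionally:

* `I` exists (`Kato2004.nonempty_iwasawaH1Data_holds`, Kato (12.2.1));
* `pair` with (P1), (P2) for EVERY `g ∈ Γ_v`, and (P3) for THE Weil pairings `LayerPairing.weilTowerPk` of the tree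
  (`LayerPairing.exists_linear_layerPairing`, w3 g4 — the (D-layer) theorem);
* the four structural properties of `weilTowerPk` (`weilTowerPk_pow/_add_left/_add_right/_smul`) and — NEW here, §1 —
  the one-step level compatibility (WEIL) `e_{p^{k+1}}(S', T') = e_{p^k}(S, T)` for `S = p S'`, `T' = T`
  (`LayerPairing.weilTowerPk_succ_of_coe_eq`, Silverman III.8.1 (e) via the tree's `weilPairingFun_mul`).

So (S3′) is EQUIVALENT IN CONTENT to its published core, and §2 proves the implication
`SignedKatoOffTwo.NoPTOfCore.layerSideNoPTTwo_of_core : CORE → (S3′ verbatim)`, where CORE is (S3′) with `I` and `pair`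
UNIVERSALLY quantified under the hypotheses (P1), (P2) (all `g`), (P3) (w.r.t. `weilTowerPk`) — by (P3) and
`LayerPairingLimit.eq_of_forall_toZModPow_eq` this `pair` is THE `T₂E`-adic local Tate pairing, unique — and with conclusion
«some local lift `g`, some plus Honda system `d` and some class `s ∈ I.H` satisfy (L)(TR)(GEN)(GEN₀) ∧ (ES) ∧ (ERL♭)»: the choice of
Kobayashi's Honda system at `2` (tree: `SignedEC.PlusLayer.plusHondaSystemTwo_adicCompletion` gives ONE such `d`), Kato's zeta
element (Thm. 12.5; tree: `exists_isEulerSystemClassTwo_of_zetaBody` modulo the construction fact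
`Kato2004.exists_eulerSystem_expStar_values`) and the explicit reciprocity law `Col♭(loc z) ~ L♭` at `p = 2` (Kobayashi Thm. 6.3 /
Sprung §7 at `2`: Otsuki 2009) — PRINT, not in the tree.  This is the «PUB core of S3′ stated on `pair`/(P3)» of the lead's v8 note,
now a by-name hypothesis.

What this does NOT do: (PT-orth) (stub S2, the lead's lane), CORE itself (PUB), hence not (S3′), not K3, not BSD.

References: [SilvermanAEC2009] III.8.1; [Kato2004Asterisque] §12.2, Thm. 12.5, §13.8, §17.13; [Kobayashi2003] Thm. 6.3, (8.23), §8.4;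
[PerrinRiou1994Invent] §3.6.1; [Sprung2012] Def. 5.9, §7.
-/

set_option autoImplicit false
-- the Theorems namespace of this sub repeats the summit name by design (D-0017 nested layout)
set_option linter.dupNamespace false

noncomputable section

open scoped Classical MatrixGroups ModularForm NumberField

/-! ## §1 (WEIL) for THE Weil pairings of the tree: one-step level compatibility of `weilTowerPk` -/

namespace Summit.BirchSwinnertonDyer.BirchSwinnertonDyer.Theorems.SignedKatoOffTwo.LayerPairing

open WeierstrassCurve Literature.NumberTheory.EllipticCurves

variable (W : WeierstrassCurve ℚ) [W.IsElliptic] {p : ℕ} [Fact p.Prime]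

/-- **Silverman III.8.1 (e), one step up the `p`-power tower, for THE Weil pairings `weilTowerPk` of the tree**:
`e_{p^{k+1}}(S', T') = e_{p^k}(S, T)` whenever `S = p • S'` and `T' = T` in `E(ℚ̄)` (`S' , T' ∈ E[p^{k+1}]`, `S, T ∈ E[p^k]`) —
the clause (WEIL) of the registered stubs `stub_ptOrthLayerTwo` / `stub_layerSideNoPTTwo` for `ePk := weilTowerPk W`.
Proof: `e_{p^k·p}(S', T) = e_{p^k}(p S', T)` (`weilPairingFun_mul`). [cite: SilvermanAEC2009, Prop. III.8.1(e)] -/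
theorem weilTowerPk_succ_of_coe_eq (k : ℕ) (S' : geomTorsion W (p ^ (k + 1))) (S : geomTorsion W (p ^ k))
    (T' : geomTorsion W (p ^ (k + 1))) (T : geomTorsion W (p ^ k))
    (hS : (S : W.geomPoints) = (p : ℤ) • (S' : W.geomPoints)) (hT : (T' : W.geomPoints) = (T : W.geomPoints)) :
    weilTowerPk W (k + 1) S' T' = weilTowerPk W k S T := by
  have hpk1 : ((p ^ k * p : ℕ) : ℚ) ≠ 0 := by
    rw [← pow_succ]; exact natCast_pow_prime_ne_zero (p := p) (k + 1)
  have hS' : ((p ^ k * p : ℕ) : ℤ) • (S' : W.geomPoints) = 0 := by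
    rw [← pow_succ]; exact zsmul_coe_geomTorsion_pow W (k + 1) S'
  have hTk : ((p ^ k : ℕ) : ℤ) • (T : W.geomPoints) = 0 := zsmul_coe_geomTorsion_pow W k T
  rw [weilTowerPk_apply, weilTowerPk_apply, hT, hS]
  -- the levels `p ^ (k + 1)` and `p ^ k * p` agree definitionally (`Nat.pow`), so Silverman III.8.1 (e) applies verbatim
  exact weilPairingFun_mul (natCast_pow_prime_ne_zero (p := p) k) hpk1 hS' hTk

/-- (WEIL) at `p = 2` in the numeral spelling of the registered stubs (`(2 : ℤ) • S'`). [cite: SilvermanAEC2009, Prop. III.8.1(e)] -/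
theorem weilTowerPk_two_succ_of_coe_eq (k : ℕ) (S' : geomTorsion W (2 ^ (k + 1))) (S : geomTorsion W (2 ^ k))
    (T' : geomTorsion W (2 ^ (k + 1))) (T : geomTorsion W (2 ^ k))
    (hS : (S : W.geomPoints) = (2 : ℤ) • (S' : W.geomPoints)) (hT : (T' : W.geomPoints) = (T : W.geomPoints)) :
    weilTowerPk (p := 2) W (k + 1) S' T' = weilTowerPk (p := 2) W k S T :=
  weilTowerPk_succ_of_coe_eq (p := 2) W k S' S T' T (by rw [hS]; norm_cast) hT

end Summit.BirchSwinnertonDyer.BirchSwinnertonDyer.Theorems.SignedKatoOffTwo.LayerPairing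

/-! ## §2 (S3′) from its published core -/

open CongruenceSubgroup WeierstrassCurve Field IsDedekindDomain NumberField
  Literature.NumberTheory.GaloisRepresentations
  Literature.NumberTheory.EllipticCurves Literature.NumberTheory.EllipticCurves.ModularForms
  Literature.NumberTheory.EllipticCurves.Module Literature.NumberTheory.EllipticCurves.Rank1Residual
  Literature.NumberTheory.EllipticCurves.Kobayashi2003 Literature.NumberTheory.EllipticCurves.Kato2004
  Literature.NumberTheory.EllipticCurves.Kato2004.EulerSystemValues Literature.NumberTheory.EllipticCurves.GreenbergSelmer
  Literature.NumberTheory.EllipticCurves.Sprung2012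
  ZpExtension Summit.BirchSwinnertonDyer.Rank1Residual.Supersingular

namespace Summit.BirchSwinnertonDyer.BirchSwinnertonDyer.Theorems.SignedKatoOffTwo.NoPTOfCore

/-- **(S3′) ⟸ CORE.** Hypothesis `hcore` (the PUBLISHED core of the registered stub `stub_layerSideNoPTTwo`, stated ON THE PAIRING):
for every place `v ∋ 2`, habitat datum (`W` non-CM, `r_an = 0`, good supersingular at `2`, `a₂ = 0`, its newform, period ratio and
Pollack pair), height-one `𝔭 ∌ 2`, EVERY pinned `I = 𝐇¹_Γ(T₂E)` and EVERY family of `ℤ₂`-linear layer pairings `pair` with (P1), (P2)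
for all `g ∈ Γ_v` and (P3) «residues mod `2^k` = `LayerPairing.layerPairingPk` for the tree's Weil pairings `weilTowerPk`» (so `pair`
is THE `T₂E`-adic local Tate pairing), there are a local lift `g` of the generator, a plus Honda system `d` ((L)(TR)(GEN)(GEN₀)) and a
class `s ∈ I.H` with (ES) `Kato2004.IsEulerSystemClassTwo W hκ I s` and (ERL♭) «for every additive glue `col₀` of `pair` along
`I.proj` and every Coleman pair `(L♯', L♭')` of `col₀ s` w.r.t. `(g, d)`: `ℓ_𝔭(Λ/(L♭')) ≤ ℓ_𝔭(Λ/(L♭))`» (Kato Thm. 12.5 zeta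
element + Kobayashi Thm. 6.3 / Sprung §7 read at `p = 2`, with Kobayashi's Honda system).  Conclusion: (S3′) VERBATIM.  Proof: `I` from
`Kato2004.nonempty_iwasawaH1Data_holds`, `pair` + (P1)(P2)(P3) from `LayerPairing.exists_linear_layerPairing`, `ePk := LayerPairing.weilTowerPk W`
with its four structural lemmas and (WEIL) := `LayerPairing.weilTowerPk_two_succ_of_coe_eq`; the rest is `hcore`.
CONDITIONAL on `hcore` only; closes nothing by itself. [cite: Kato2004Asterisque, §12.2 (p. 220), Thm. 12.5 (p. 222), §13.8 (pp. 228–229), §17.13 (p. 279)]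
[cite: Kobayashi2003, Thm. 6.3 (p. 11), (8.23) (p. 18)] [cite: PerrinRiou1994Invent, §3.6.1] [cite: Sprung2012, Def. 5.9 (p. 1495), §7]
[cite: SilvermanAEC2009, Prop. III.8.1] -/
theorem layerSideNoPTTwo_of_core
    (hcore :
      ∀ (v : HeightOneSpectrum (𝓞 ℚ)), ((2 : ℕ) : 𝓞 ℚ) ∈ v.asIdeal →
      ∀ (W : WeierstrassCurve ℚ) [W.IsElliptic] [W.IsGloballyMinimal],
        ¬ W.HasCM → W.analyticRank = 0 → GoodSS W 2 → W.frobeniusTrace 2 = 0 →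
        ∀ (κ : ZpExtension ℚ 2) (γ : Field.absoluteGaloisGroup ℚ) (hκ : κ.IsCyclotomic),
          κ.IsTopGenerator γ → IsCyclotomicVariable 2 γ →
          ∀ [NeZero (W.conductorNorm ℤ)] (f : CuspForm (Gamma0 (W.conductorNorm ℤ)) 2),
            IsNewformOf W f → ∀ (ϖ : ℚ), (ϖ : ℝ) * W.realPeriodRat = plusPeriod f →
          ∀ (Lplus Lminus : IwasawaAlgebra 2), IsPollackPair f 2 Lplus Lminus →
          ∀ [ContinuousSMul ℤ_[2] (W.tateModule 2)] [Module.Free ℤ_[2] (W.tateModule 2)]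
            [Module.Finite ℤ_[2] (W.tateModule 2)],
          ∀ 𝔭 : PrimeSpectrum (IwasawaAlgebra 2), 𝔭.asIdeal.height = 1 →
            PowerSeries.C (2 : ℤ_[2]) ∉ 𝔭.asIdeal →
          ∀ (I : Kato2004.IwasawaH1Data W 2 κ γ)
            (pair : ∀ n : ℕ, H1 (tateRep W 2) (κ.layerSubgroup n) →ₗ[ℤ_[2]]
              (localLayerPointsOfEmb κ (closureEmb (K := ℚ) (v.adicCompletion ℚ)) W n →+ ℤ_[2])),
            -- (P1) projection formula
            (∀ (n : ℕ) (x : H1 (tateRep W 2) (κ.layerSubgroup (n + 1))) (Q : localPoints W (v.adicCompletion ℚ))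
              (hQ : Q ∈ localLayerPointsOfEmb κ (closureEmb (K := ℚ) (v.adicCompletion ℚ)) W n),
              pair n (layerCores (tateRep W 2) κ n x) ⟨Q, hQ⟩ =
                pair (n + 1) x ⟨Q, localLayerPointsOfEmb_mono κ (closureEmb (K := ℚ) (v.adicCompletion ℚ)) W (Nat.le_succ n) hQ⟩) →
            -- (P2) Galois invariance, for EVERY `g ∈ Γ_v`
            (∀ (n : ℕ) (g : absoluteGaloisGroup (v.adicCompletion ℚ)) (y : H1 (tateRep W 2) (κ.layerSubgroup n))
              (Q : localPoints W (v.adicCompletion ℚ))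
              (hQ : Q ∈ localLayerPointsOfEmb κ (closureEmb (K := ℚ) (v.adicCompletion ℚ)) W n),
              pair n (conjMap (tateRep W 2).toTopRep (κ.layerSubgroup n) (resGalOfEmb (closureEmb (K := ℚ) (v.adicCompletion ℚ)) g) 1 y)
                ⟨g • Q, smul_mem_localLayerPointsOfEmb κ (closureEmb (K := ℚ) (v.adicCompletion ℚ)) W n g hQ⟩ = pair n y ⟨Q, hQ⟩) →
            -- (P3) `pair` IS the `T₂E`-adic local Tate pairing: residues = the (D-layer) pairings for THE Weil pairings of the tree
            (∀ (n k : ℕ) (x : H1 (tateRep W 2) (κ.layerSubgroup n))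
              (Q : localLayerPointsOfEmb κ (closureEmb (K := ℚ) (v.adicCompletion ℚ)) W n),
              PadicInt.toZModPow k (pair n x Q) =
                LayerPairing.layerPairingPk W κ v (LayerPairing.weilTowerPk W) (LayerPairing.weilTowerPk_pow W)
                  (LayerPairing.weilTowerPk_add_left W) (LayerPairing.weilTowerPk_add_right W) (LayerPairing.weilTowerPk_smul W)
                  n k x Q) →
          ∃ (g : absoluteGaloisGroup (v.adicCompletion ℚ))
            (_ : κ.IsTopGenerator (resGalOfEmb (closureEmb (K := ℚ) (v.adicCompletion ℚ)) g))
            (d : ℕ → localPoints W (v.adicCompletion ℚ)) (s : I.H),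
            (∀ n, d n ∈ localLayerPointsOfEmb κ (closureEmb (K := ℚ) (v.adicCompletion ℚ)) W n) ∧
            (∀ n, localTraceOfEmb κ (closureEmb (K := ℚ) (v.adicCompletion ℚ)) W (n + 1) (n + 2) (d (n + 2)) = -d n) ∧
            (∀ n : ℕ, 1 ≤ n → ∀ P ∈ localLayerPointsOfEmb κ (closureEmb (K := ℚ) (v.adicCompletion ℚ)) W n,
              ∃ B ∈ AddSubgroup.closure (Set.range fun σ : absoluteGaloisGroup (v.adicCompletion ℚ) ↦ σ • d n),
                ∃ P' ∈ localLayerPointsOfEmb κ (closureEmb (K := ℚ) (v.adicCompletion ℚ)) W (n - 1),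
                ∃ R ∈ localLayerPointsOfEmb κ (closureEmb (K := ℚ) (v.adicCompletion ℚ)) W n, P = B + P' + 2 • R) ∧
            (∀ P ∈ localLayerPointsOfEmb κ (closureEmb (K := ℚ) (v.adicCompletion ℚ)) W 0,
              ∃ a : ℤ, ∃ R ∈ localLayerPointsOfEmb κ (closureEmb (K := ℚ) (v.adicCompletion ℚ)) W 0, P = a • d 0 + 2 • R) ∧
            Kato2004.IsEulerSystemClassTwo W hκ I s ∧
            (∀ col₀ : I.H →+ (localTowerPointsOfEmb κ (closureEmb (K := ℚ) (v.adicCompletion ℚ)) W →+ ℤ_[2]),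
              (∀ (n : ℕ) (x : I.H) (Q : localPoints W (v.adicCompletion ℚ)) (hQ : Q ∈ localLayerPointsOfEmb κ (closureEmb (K := ℚ) (v.adicCompletion ℚ)) W n),
                col₀ x ⟨Q, localLayerPointsOfEmb_le_localTowerPointsOfEmb κ (closureEmb (K := ℚ) (v.adicCompletion ℚ)) W n hQ⟩ = pair n (I.proj n x) ⟨Q, hQ⟩) →
              ∀ Ls Lf : IwasawaAlgebra 2, IsColemanPair κ (closureEmb (K := ℚ) (v.adicCompletion ℚ)) W 0 g d (col₀ s) Ls Lf →
                lengthAt (IwasawaAlgebra 2) (IwasawaAlgebra 2 ⧸ Ideal.span {Lf}) 𝔭 ≤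
                  lengthAt (IwasawaAlgebra 2) (IwasawaAlgebra 2 ⧸ Ideal.span {kobayashiL 1 Lplus Lminus}) 𝔭)) :
    ∀ (v : HeightOneSpectrum (𝓞 ℚ)), ((2 : ℕ) : 𝓞 ℚ) ∈ v.asIdeal →
    ∀ (W : WeierstrassCurve ℚ) [W.IsElliptic] [W.IsGloballyMinimal],
      ¬ W.HasCM → W.analyticRank = 0 → GoodSS W 2 → W.frobeniusTrace 2 = 0 →
      ∀ (κ : ZpExtension ℚ 2) (γ : Field.absoluteGaloisGroup ℚ) (hκ : κ.IsCyclotomic),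
        κ.IsTopGenerator γ → IsCyclotomicVariable 2 γ →
        ∀ [NeZero (W.conductorNorm ℤ)] (f : CuspForm (Gamma0 (W.conductorNorm ℤ)) 2),
          IsNewformOf W f → ∀ (ϖ : ℚ), (ϖ : ℝ) * W.realPeriodRat = plusPeriod f →
        ∀ (Lplus Lminus : IwasawaAlgebra 2), IsPollackPair f 2 Lplus Lminus →
        ∀ [ContinuousSMul ℤ_[2] (W.tateModule 2)] [Module.Free ℤ_[2] (W.tateModule 2)]
          [Module.Finite ℤ_[2] (W.tateModule 2)],
        ∀ 𝔭 : PrimeSpectrum (IwasawaAlgebra 2), 𝔭.asIdeal.height = 1 →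
          PowerSeries.C (2 : ℤ_[2]) ∉ 𝔭.asIdeal →
        ∃ (g : absoluteGaloisGroup (v.adicCompletion ℚ))
          (_ : κ.IsTopGenerator (resGalOfEmb (closureEmb (K := ℚ) (v.adicCompletion ℚ)) g))
          (d : ℕ → localPoints W (v.adicCompletion ℚ))
          (I : Kato2004.IwasawaH1Data W 2 κ γ)
          (pair : ∀ n : ℕ, H1 (tateRep W 2) (κ.layerSubgroup n) →ₗ[ℤ_[2]]
            (localLayerPointsOfEmb κ (closureEmb (K := ℚ) (v.adicCompletion ℚ)) W n →+ ℤ_[2]))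
          (s : I.H)
          (ePk : ∀ k : ℕ, geomTorsion W (2 ^ k) → geomTorsion W (2 ^ k) → AlgebraicClosure ℚ)
          (hμ : ∀ k S T, ePk k S T ^ (2 ^ k) = 1)
          (hadd₁ : ∀ k S₁ S₂ T, ePk k (S₁ + S₂) T = ePk k S₁ T * ePk k S₂ T)
          (hadd₂ : ∀ k S T₁ T₂, ePk k S (T₁ + T₂) = ePk k S T₁ * ePk k S T₂)
          (hgal : ∀ k (σ : absoluteGaloisGroup ℚ) (S T : geomTorsion W (2 ^ k)), σ • ePk k S T = ePk k (σ • S) (σ • T)),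
          (∀ n, d n ∈ localLayerPointsOfEmb κ (closureEmb (K := ℚ) (v.adicCompletion ℚ)) W n) ∧
          (∀ n, localTraceOfEmb κ (closureEmb (K := ℚ) (v.adicCompletion ℚ)) W (n + 1) (n + 2) (d (n + 2)) = -d n) ∧
          (∀ n : ℕ, 1 ≤ n → ∀ P ∈ localLayerPointsOfEmb κ (closureEmb (K := ℚ) (v.adicCompletion ℚ)) W n,
            ∃ B ∈ AddSubgroup.closure (Set.range fun σ : absoluteGaloisGroup (v.adicCompletion ℚ) ↦ σ • d n),
              ∃ P' ∈ localLayerPointsOfEmb κ (closureEmb (K := ℚ) (v.adicCompletion ℚ)) W (n - 1),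
              ∃ R ∈ localLayerPointsOfEmb κ (closureEmb (K := ℚ) (v.adicCompletion ℚ)) W n, P = B + P' + 2 • R) ∧
          (∀ P ∈ localLayerPointsOfEmb κ (closureEmb (K := ℚ) (v.adicCompletion ℚ)) W 0,
            ∃ a : ℤ, ∃ R ∈ localLayerPointsOfEmb κ (closureEmb (K := ℚ) (v.adicCompletion ℚ)) W 0, P = a • d 0 + 2 • R) ∧
          (∀ (n : ℕ) (x : H1 (tateRep W 2) (κ.layerSubgroup (n + 1))) (Q : localPoints W (v.adicCompletion ℚ))
            (hQ : Q ∈ localLayerPointsOfEmb κ (closureEmb (K := ℚ) (v.adicCompletion ℚ)) W n),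
            pair n (layerCores (tateRep W 2) κ n x) ⟨Q, hQ⟩ =
              pair (n + 1) x ⟨Q, localLayerPointsOfEmb_mono κ (closureEmb (K := ℚ) (v.adicCompletion ℚ)) W (Nat.le_succ n) hQ⟩) ∧
          (∀ (n : ℕ) (y : H1 (tateRep W 2) (κ.layerSubgroup n)) (Q : localPoints W (v.adicCompletion ℚ))
            (hQ : Q ∈ localLayerPointsOfEmb κ (closureEmb (K := ℚ) (v.adicCompletion ℚ)) W n),
            pair n (conjMap (tateRep W 2).toTopRep (κ.layerSubgroup n) (resGalOfEmb (closureEmb (K := ℚ) (v.adicCompletion ℚ)) g) 1 y)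
              ⟨g • Q, smul_mem_localLayerPointsOfEmb κ (closureEmb (K := ℚ) (v.adicCompletion ℚ)) W n g hQ⟩ = pair n y ⟨Q, hQ⟩) ∧
          -- (WEIL) one-step level compatibility of the family `e_k`
          (∀ (k : ℕ) (S' : geomTorsion W (2 ^ (k + 1))) (S : geomTorsion W (2 ^ k)) (T' : geomTorsion W (2 ^ (k + 1)))
            (T : geomTorsion W (2 ^ k)), (S : W.geomPoints) = (2 : ℤ) • (S' : W.geomPoints) →
            (T' : W.geomPoints) = (T : W.geomPoints) → ePk (k + 1) S' T' = ePk k S T) ∧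
          -- (P3) the residue clause: `pair` is THE local Tate pairing of the (D-layer) construction
          (∀ (n k : ℕ) (x : H1 (tateRep W 2) (κ.layerSubgroup n))
            (Q : localLayerPointsOfEmb κ (closureEmb (K := ℚ) (v.adicCompletion ℚ)) W n),
            PadicInt.toZModPow k (pair n x Q) = LayerPairing.layerPairingPk W κ v ePk hμ hadd₁ hadd₂ hgal n k x Q) ∧
          Kato2004.IsEulerSystemClassTwo W hκ I s ∧
          (∀ col₀ : I.H →+ (localTowerPointsOfEmb κ (closureEmb (K := ℚ) (v.adicCompletion ℚ)) W →+ ℤ_[2]),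
            (∀ (n : ℕ) (x : I.H) (Q : localPoints W (v.adicCompletion ℚ)) (hQ : Q ∈ localLayerPointsOfEmb κ (closureEmb (K := ℚ) (v.adicCompletion ℚ)) W n),
              col₀ x ⟨Q, localLayerPointsOfEmb_le_localTowerPointsOfEmb κ (closureEmb (K := ℚ) (v.adicCompletion ℚ)) W n hQ⟩ = pair n (I.proj n x) ⟨Q, hQ⟩) →
            ∀ Ls Lf : IwasawaAlgebra 2, IsColemanPair κ (closureEmb (K := ℚ) (v.adicCompletion ℚ)) W 0 g d (col₀ s) Ls Lf →
              lengthAt (IwasawaAlgebra 2) (IwasawaAlgebra 2 ⧸ Ideal.span {Lf}) 𝔭 ≤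
                lengthAt (IwasawaAlgebra 2) (IwasawaAlgebra 2 ⧸ Ideal.span {kobayashiL 1 Lplus Lminus}) 𝔭) := by
  intro v hv W _ _ hcm hr hss ha κ γ hκ hγ hvar _ f hf ϖ hϖ Lplus Lminus hPol _ _ _ 𝔭 h𝔭 h2
  -- the pinned `𝐇¹_Γ(T₂E)` (Kato (12.2.1), tree theorem)
  obtain ⟨I⟩ := (Kato2004.nonempty_iwasawaH1Data_holds W 2 κ γ hκ hγ :
    Nonempty (Kato2004.IwasawaH1Data W 2 κ γ))
  -- THE layer pairings of the (D-layer) construction with (P3), (P1), (P2) (tree theorem, w3 g4)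
  obtain ⟨pair, hP3, hP1, hP2⟩ := LayerPairing.exists_linear_layerPairing W κ v hκ hv
  -- the published core
  obtain ⟨g, hg, d, s, hL, hTR, hGEN, hGEN0, hES, hERL⟩ :=
    hcore v hv W hcm hr hss ha κ γ hκ hγ hvar f hf ϖ hϖ Lplus Lminus hPol 𝔭 h𝔭 h2 I pair hP1 hP2 hP3
  exact ⟨g, hg, d, I, pair, s, LayerPairing.weilTowerPk W, LayerPairing.weilTowerPk_pow W,
    LayerPairing.weilTowerPk_add_left W, LayerPairing.weilTowerPk_add_right W, LayerPairing.weilTowerPk_smul W,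
    hL, hTR, hGEN, hGEN0, hP1, fun n y Q hQ ↦ hP2 n g y Q hQ,
    fun k S' S T' T hS hT ↦ LayerPairing.weilTowerPk_two_succ_of_coe_eq W k S' S T' T hS hT, hP3, hES, hERL⟩

end Summit.BirchSwinnertonDyer.BirchSwinnertonDyer.Theorems.SignedKatoOffTwo.NoPTOfCore

end
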